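import Summits.CriticalPhenomena.PercolationContinuityZ3.Theorems.PercNearOneGluingNoHeavyLowerTailAPLGluedClusters
import Summits.CriticalPhenomena.PercolationContinuityZ3.Theorems.PercNearOneGluingNoHeavyLowerTailCubicThreePointGluing
import Summits.CriticalPhenomena.PercolationContinuityZ3.Theorems.PercNearOneGluingNoHeavyLowerTailRefinedRowR3Switching
import HarnessLib

/-!
# `NoHeavyLowerTail` (stmt-CriticalPhenomena-4575) — the 3-sum theorem for R1, measure level, part 2:
# the three-point cells of a configuration glued along `{a,b,c}` (join rule and separation rule)

Support file (prover prim-gen-kcluster gen 71; `--supports stmt-CriticalPhenomena-4575`).  Pure graph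
combinatorics: no measures, no definitions, no named facts, no sorries.

Blueprint KCLUSTER-gen69.md §5.1 / §9 (N3b) steps (2) and (6): two edge sets `ζ_A`, `ζ_B` (open pairs of the
two pieces) whose pairs MEET ONLY IN THE TERMINALS `a, b, c`.

The JOIN RULE (`b ∈ cl (ζ_A ∪ ζ_B) a` iff `a ~ b` inside one piece, or `a ~ c` inside one piece and `c ~ b`
inside one piece) is the tree's `APL.glued_ab_iff` / `APL.glued_ac_iff` (prim-ineq-gen-8,
`…LowerTailAPLGluedClusters`); this file adds what the SEPARATING cell `S_a` of R1 needs.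
* `ThreeSum.cl_union_eq` — if `b, c` are not in the cluster of `a` in either piece, the cluster of `a` in
  the glued configuration is the union of the two piece clusters (and still misses `b, c`).
* `ThreeSum.sep_union_iff` — **SEPARATION RULE**: in that case, with supports `D_A ⊇ ζ_A`, `D_B ⊇ ζ_B`
  meeting only in `{a,b,c}`, the glued cluster of `a` meets every `b–c` path of the glued support
  `D_A ∪ D_B` iff each piece cluster meets every `b–c` path of its own support
  (`RefinedRowR3.Sep`): a `b–c` path avoiding the cluster of `a` avoids `a`, hence lies in one piece.
These are the pointwise facts behind the six-cell dictionary of the 3-sum theorem (parts 3–4).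
[cite: Grimmett1999, §2.2 (independence / decoupling across separating sets — pattern only)]
-/

namespace Summit.CriticalPhenomena.PercolationContinuityZ3.Theorems

namespace ThreeSum

open SimpleGraph Finset Literature.Probability.Percolation Literature.Probability.Percolation.Gladkov
open TerminalGluing RefinedRowR3 ThreePointLB APL
open scoped Classical

variable {V : Type*}

/-! ### The cluster of `a` in a glued configuration -/

section Cluster

variable [Fintype V] {ζA ζB : Finset (Sym2 V)} {a b c : V}

/-- **The glued cluster of `a` off `b, c`.**  If the pairs of `ζ_A` and `ζ_B` meet only in `{a,b,c}` and
`b, c` are not in the cluster of `a` in either piece, then the cluster of `a` in `ζ_A ∪ ζ_B` is the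
union of the two piece clusters. [this work] -/
theorem cl_union_eq
    (hsep : ∀ v : V, (∃ e ∈ ζA, v ∈ e) → (∃ e ∈ ζB, v ∈ e) → (v = a ∨ v = b ∨ v = c))
    (hbA : b ∉ cl ζA a) (hcA : c ∉ cl ζA a) (hbB : b ∉ cl ζB a) (hcB : c ∉ cl ζB a) :
    cl (ζA ∪ ζB) a = cl ζA a ∪ cl ζB a := by
  apply Finset.Subset.antisymm
  · -- the union of the piece clusters is closed under glued adjacency
    set C : Finset V := cl ζA a ∪ cl ζB a with hC
    have hclosed : ∀ u v, u ∈ C → (openGraph (↑(ζA ∪ ζB) : Set (Sym2 V))).Adj u v → v ∈ C := by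
      intro u v hu huv
      rw [adj_iff, Finset.mem_union] at huv
      obtain ⟨he | he, hne⟩ := huv
      · -- a `ζ_A`-pair at `u`
        rcases Finset.mem_union.1 hu with huA | huB
        · exact Finset.mem_union.2 (Or.inl (mem_cl_of_adj huA (adj_iff.2 ⟨he, hne⟩)))
        · -- `u` in the `B`-cluster: `u` is a terminal, hence `u = a`
          by_cases hua : u = a
          · subst hua
            exact Finset.mem_union.2 (Or.inl (mem_cl_of_adj (mem_cl_self _ _) (adj_iff.2 ⟨he, hne⟩)))
          · rcases hsep u ⟨_, he, Sym2.mem_mk_left u v⟩ (exists_mem_edge_of_mem_cl huB hua) with h | h | h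
            · exact absurd h hua
            · exact absurd (h ▸ huB) hbB
            · exact absurd (h ▸ huB) hcB
      · -- a `ζ_B`-pair at `u`
        rcases Finset.mem_union.1 hu with huA | huB
        · by_cases hua : u = a
          · subst hua
            exact Finset.mem_union.2 (Or.inr (mem_cl_of_adj (mem_cl_self _ _) (adj_iff.2 ⟨he, hne⟩)))
          · rcases hsep u (exists_mem_edge_of_mem_cl huA hua) ⟨_, he, Sym2.mem_mk_left u v⟩ with h | h | h
            · exact absurd h hua
            · exact absurd (h ▸ huA) hbA
            · exact absurd (h ▸ huA) hcA
        · exact Finset.mem_union.2 (Or.inr (mem_cl_of_adj huB (adj_iff.2 ⟨he, hne⟩)))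
    intro v hv
    obtain ⟨w⟩ := mem_cl.1 hv
    exact mem_of_walk hclosed w (Finset.mem_union.2 (Or.inl (mem_cl_self _ _)))
  · exact Finset.union_subset (cl_mono Finset.subset_union_left a) (cl_mono Finset.subset_union_right a)

/-- Under the hypotheses of `cl_union_eq`, `b` is not in the glued cluster of `a`. [this work] -/
theorem not_mem_cl_union_b
    (hsep : ∀ v : V, (∃ e ∈ ζA, v ∈ e) → (∃ e ∈ ζB, v ∈ e) → (v = a ∨ v = b ∨ v = c))
    (hbA : b ∉ cl ζA a) (hcA : c ∉ cl ζA a) (hbB : b ∉ cl ζB a) (hcB : c ∉ cl ζB a) :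
    b ∉ cl (ζA ∪ ζB) a := by
  rw [cl_union_eq hsep hbA hcA hbB hcB, Finset.mem_union, not_or]; exact ⟨hbA, hbB⟩

/-- Under the hypotheses of `cl_union_eq`, `c` is not in the glued cluster of `a`. [this work] -/
theorem not_mem_cl_union_c
    (hsep : ∀ v : V, (∃ e ∈ ζA, v ∈ e) → (∃ e ∈ ζB, v ∈ e) → (v = a ∨ v = b ∨ v = c))
    (hbA : b ∉ cl ζA a) (hcA : c ∉ cl ζA a) (hbB : b ∉ cl ζB a) (hcB : c ∉ cl ζB a) :
    c ∉ cl (ζA ∪ ζB) a := by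
  rw [cl_union_eq hsep hbA hcA hbB hcB, Finset.mem_union, not_or]; exact ⟨hcA, hcB⟩

end Cluster

/-! ### The separation rule -/

section Separation

variable [Fintype V] {DA DB ζA ζB : Finset (Sym2 V)} {a b c : V}

/-- Off the cluster of `a`, a support pair of piece `A` is not touched by the `B`-cluster of `a` (when `b, c`
are outside it). [this work] -/
theorem sdiff_touch_union_left
    (hsepD : ∀ v : V, (∃ e ∈ DA, v ∈ e) → (∃ e ∈ DB, v ∈ e) → (v = a ∨ v = b ∨ v = c))
    (hζB : ζB ⊆ DB) (hbB : b ∉ cl ζB a) (hcB : c ∉ cl ζB a) :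
    DA \ touch (cl ζA a ∪ cl ζB a) = DA \ touch (cl ζA a) := by
  ext e
  simp only [Finset.mem_sdiff, mem_touch, Finset.mem_union, not_exists, not_and]
  constructor
  · rintro ⟨he, h⟩; exact ⟨he, fun v hv hve => h v (Or.inl hv) hve⟩
  · rintro ⟨he, h⟩
    refine ⟨he, fun v hv hve => ?_⟩
    rcases hv with hv | hv
    · exact h v hv hve
    · by_cases hva : v = a
      · subst hva; exact h v (mem_cl_self _ _) hve
      · obtain ⟨e', he', hve'⟩ := exists_mem_edge_of_mem_cl hv hva
        rcases hsepD v ⟨e, he, hve⟩ ⟨e', hζB he', hve'⟩ with h' | h' | h'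
        · exact hva h'
        · exact hbB (h' ▸ hv)
        · exact hcB (h' ▸ hv)

/-- Off the cluster of `a`, a support pair of piece `B` is not touched by the `A`-cluster of `a`. [this work] -/
theorem sdiff_touch_union_right
    (hsepD : ∀ v : V, (∃ e ∈ DA, v ∈ e) → (∃ e ∈ DB, v ∈ e) → (v = a ∨ v = b ∨ v = c))
    (hζA : ζA ⊆ DA) (hbA : b ∉ cl ζA a) (hcA : c ∉ cl ζA a) :
    DB \ touch (cl ζA a ∪ cl ζB a) = DB \ touch (cl ζB a) := by
  have hsepD' : ∀ v : V, (∃ e ∈ DB, v ∈ e) → (∃ e ∈ DA, v ∈ e) → (v = a ∨ v = b ∨ v = c) :=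
    fun v h1 h2 => hsepD v h2 h1
  rw [Finset.union_comm]
  exact sdiff_touch_union_left hsepD' hζA hbA hcA

/-- In a support with the pairs at `a` removed (`a ∈ W`), nothing is reachable from `a` but `a`. [folklore] -/
theorem reachable_sdiff_touch_a {D : Finset (Sym2 V)} {W : Finset V} (ha : a ∈ W) {v : V}
    (h : (openGraph (↑(D \ touch W) : Set (Sym2 V))).Reachable a v) : v = a := by
  by_contra hva
  obtain ⟨u, hu⟩ := exists_adj_of_reachable_ne h (Ne.symm hva)
  rw [adj_iff, Finset.mem_sdiff] at hu
  exact hu.1.2 (mk_mem_touch.2 (Or.inl ha))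

/-- **Separation rule.**  Let the supports `D_A ⊇ ζ_A`, `D_B ⊇ ζ_B` meet only in `{a,b,c}` (`a, b, c` distinct)
and let `b, c` lie outside the cluster of `a` in both pieces.  Then the glued cluster of `a` meets every
`b–c` path of `D_A ∪ D_B` iff, for each piece, the piece cluster of `a` meets every `b–c` path of the
piece support.  (A `b–c` path avoiding the cluster of `a` avoids `a`, so it crosses no terminal and lies in
one piece.) [this work] -/
theorem sep_union_iff
    (hsepD : ∀ v : V, (∃ e ∈ DA, v ∈ e) → (∃ e ∈ DB, v ∈ e) → (v = a ∨ v = b ∨ v = c))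
    (hζA : ζA ⊆ DA) (hζB : ζB ⊆ DB) (hab : a ≠ b)
    (hbA : b ∉ cl ζA a) (hcA : c ∉ cl ζA a) (hbB : b ∉ cl ζB a) (hcB : c ∉ cl ζB a) :
    Sep (DA ∪ DB) (cl (ζA ∪ ζB) a) b c ↔ Sep DA (cl ζA a) b c ∧ Sep DB (cl ζB a) b c := by
  have hsep : ∀ v : V, (∃ e ∈ ζA, v ∈ e) → (∃ e ∈ ζB, v ∈ e) → (v = a ∨ v = b ∨ v = c) :=
    fun v ⟨e, he, hve⟩ ⟨e', he', hve'⟩ => hsepD v ⟨e, hζA he, hve⟩ ⟨e', hζB he', hve'⟩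
  unfold RefinedRowR3.Sep
  rw [cl_union_eq hsep hbA hcA hbB hcB, Finset.union_sdiff_distrib,
    sdiff_touch_union_left hsepD hζB hbB hcB, sdiff_touch_union_right hsepD hζA hbA hcA]
  -- the support off the clusters is glued from two pieces meeting only in `{a,b,c}` (roles `(b; c, a)`)
  set EA := DA \ touch (cl ζA a) with hEA
  set EB := DB \ touch (cl ζB a) with hEB
  have hsepE : ∀ v : V, (∃ e ∈ EA, v ∈ e) → (∃ e ∈ EB, v ∈ e) → (v = b ∨ v = c ∨ v = a) := by
    rintro v ⟨e, he, hve⟩ ⟨e', he', hve'⟩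
    rw [hEA, Finset.mem_sdiff] at he
    rw [hEB, Finset.mem_sdiff] at he'
    rcases hsepD v ⟨e, he.1, hve⟩ ⟨e', he'.1, hve'⟩ with h | h | h <;> tauto
  have key := APL.glued_ab_iff EA EB b c a hsepE
  -- `a` is isolated in both pieces off the clusters
  have isoA : a ∉ cl EA b := fun h =>
    hab (reachable_sdiff_touch_a (D := DA) (mem_cl_self ζA a) (mem_cl.1 h).symm).symm
  have isoB : a ∉ cl EB b := fun h =>
    hab (reachable_sdiff_touch_a (D := DB) (mem_cl_self ζB a) (mem_cl.1 h).symm).symm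
  rw [key]
  constructor
  · intro h
    exact ⟨fun hA => h (Or.inl (Or.inl hA)), fun hB => h (Or.inl (Or.inr hB))⟩
  · rintro ⟨hA, hB⟩ (h | ⟨h, _⟩)
    · exact h.elim hA hB
    · exact h.elim isoA isoB

/-- **An open `b–c` path off the cluster of `a` defeats separation**: if `ζ ⊆ D`, `b ∉ cl ζ a` and
`c ∈ cl ζ b`, then the cluster of `a` does not meet every `b–c` path of `D`. [this work] -/
theorem not_sep_of_mem_cl {D ζ : Finset (Sym2 V)} (hζ : ζ ⊆ D) (hb : b ∉ cl ζ a) (hc : c ∈ cl ζ b) :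
    ¬ Sep D (cl ζ a) b c := by
  intro h
  unfold RefinedRowR3.Sep at h
  refine h (cl_subset_cl_sdiff_touch hζ (fun v hv hva => ?_) hc)
  exact hb (mem_cl.2 ((mem_cl.1 hva).trans (mem_cl.1 hv).symm))

end Separation

end ThreeSum

end Summit.CriticalPhenomena.PercolationContinuityZ3.Theorems
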